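import Literature.NumberTheory.EllipticCurves.OrdinaryReductionKernelTorsionProofs
import Literature.NumberTheory.EllipticCurves.ZpExtensionEisensteinOrdinaryFiltration
import HarnessLib

/-!
# `Fil_v E[p^k] = E[p^k] ∩ E₁(K̄_v)` is cyclic at a place `v ∣ p` of good ORDINARY reduction, hence isotropic for any
# alternating pairing (theorems only; no definition, no named fact, no instance, no `sorry`)

Topic `NumberTheory/EllipticCurves` (cell `pub/bsd-print-x9`, D1 road; input (E1) of the memo `HOME/p1/H4-AT-P-PLAN`:
Howard's H.4 at `v ∣ p` for the ordinary Selmer structure `F_𝔮`, whose plus part at level `k` is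
`WeierstrassCurve.torsionFilAt W v (p^k)` of `ZpExtensionEisensteinOrdinaryFiltration`).

Greenberg [LNM 1716, §1 p. 62, §2 pp. 82–83]: at a prime of good ordinary reduction the kernel of reduction on
`p`-power torsion is `ℱ[p^∞] = ker (E[p^∞] → Ẽ[p^∞]) ≅ ℚ_p/ℤ_p`; in particular `ℱ[p^k] = E[p^k] ∩ E₁` is cyclic of order
`p^k`. Howard [Howard 2004, §3.1, arXiv:1202.6340 p. 15 L56–62]: `Fil_v T = ker (T_p E → T_p Ẽ)` and (Lemma 3.1.1)
`Fil_v T_𝔭` «is its own exact orthogonal complement under `e_𝔭`» — isotropy because the Weil pairing is alternating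
and `Fil_v T` has rank one. The tree proves the cyclicity for a Weierstrass equation with unit discriminant over a
valuation ring of an algebraically closed field under the hypothesis «some `p`-torsion point has non-zero reduction»
(`OrdinaryReductionKernelTorsionProofs` §5: `exists_generator_torsionBy_ker_goodReductionHom`,
`exists_nsmul_eq_of_goodReductionHom_eq_zero`). This file TRANSPORTS it to the number-field objects of the D1 road:

* §1 (local, `E(K̄_v)`): for `E/K` with good reduction at `v ∋ p` and an ORDINARY POINT «some `p`-torsion point of
  `E(K̄_v)` lies outside `E₁(K̄_v) = localKernelOfReduction v`»: **`exists_generator_localKernelOfReduction_torsion`**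
  (`E₁(K̄_v) ∩ E[p^k]` is cyclic on a generator of order `p^k`) and `exists_nsmul_eq_of_mem_localKernelOfReduction`
  (`E₁(K̄_v)` is `p`-divisible) — via the spectral model `localSpectralModel v` over the valuation ring of `|·|_v` on
  `K̄_v` (`mem_localKernelOfReduction_iff` + `goodReductionHom_eq_zero_iff`, as in
  `mem_localKernelOfReduction_of_prime_nsmul_mem`), the residue characteristic being `p` along `residueFieldToSpectral`.
* §2 (global torsion, `E[p^k] ⊂ E(K̄)`): **`exists_generator_torsionFilAt`** — `Fil_v E[p^k] = torsionFilAt W v (p^k)` is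
  cyclic (it embeds, by the injective `pointsMapOfEmb`, into the cyclic `E₁(K̄_v) ∩ E[p^k]`); the ordinary-point
  hypothesis may be given on `E(K̄)` (`exists_generator_torsionFilAt_of_not_mem`).
* §3 **`pairing_torsionFilAt_eq_zero`** — consequently every bi-additive `e` on `E[p^k]` with `e(a, a) = 0` (the Weil
  pairing) vanishes on `Fil_v × Fil_v` (`e(c P₀, d P₀) = c d e(P₀, P₀)`): the `E`-level isotropy consumed by
  `ZpExtensionEisensteinTwistFilIsotropyProofs` (H.4 at `v ∣ p`, isotropy of the strict ordinary cores).

The ordinary-point hypothesis is Greenberg's/Howard's «good ORDINARY reduction» in the form the proofs use; its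
derivation from `HasUnitRootAt` (`p ∤ a_v`) is not in this file. BSD is not proved by any of this.

References: [GreenbergLNM1716] R. Greenberg, LNM 1716 (1999), §1 p. 62, §2 pp. 82–83 (Props. 2.2, 2.4);
[Howard2004HeegnerKolyvagin] B. Howard, Compositio Math. 140 (2004), §3.1 and Lemma 3.1.1 (arXiv p. 15, L56–62);
[SilvermanAEC2009] VII.2.1–2.2 (`E₁`), VII.3.1, III.8.1 (Weil pairing alternating).
-/

noncomputable section

open scoped NNReal
open NumberField IsDedekindDomain Field

namespace WeierstrassCurve

open Literature.NumberTheory.EllipticCurves Literature.NumberTheory.GaloisRepresentations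
  IsDedekindDomain.HeightOneSpectrum AddSubgroup

universe u

variable {K : Type u} [Field K] [NumberField K] (W : WeierstrassCurve K)
  (v : HeightOneSpectrum (𝓞 K)) {p : ℕ} [hp : Fact p.Prime]

/-! ## §1 `E₁(K̄_v) ∩ E[p^k]` is cyclic of order `p^k`; `E₁(K̄_v)` is `p`-divisible -/

/-- **The ordinary filtration on `E(K̄_v)` at a place `v ∋ p` of good reduction with an ordinary point** (transport of
`OrdinaryReductionKernelTorsionProofs` §5 to `E₁(K̄_v) = localKernelOfReduction v` along the spectral model): for every
`k` there is `P₁ ∈ E₁(K̄_v)` of order exactly `p^k` such that every `P ∈ E₁(K̄_v)` with `p^k P = 0` is a multiple of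
`P₁` — `E₁(K̄_v) ∩ E[p^k] = Ê[p^k]` is cyclic of order `p^k`; and `E₁(K̄_v)` is `p`-divisible.
[cite: GreenbergLNM1716, §1 p. 62 and §2 pp. 82–83 (ℱ[p^∞] ≅ ℚ_p/ℤ_p, 𝓕(𝔪̄) divisible)]
[cite: SilvermanAEC2009, Prop. VII.2.1–2.2] -/
theorem localKernelOfReduction_ordinary_filtration (hgood : W.HasGoodReductionAt v) (hpv : (p : 𝓞 K) ∈ v.asIdeal)
    (hord : ∃ P : localPoints W (v.adicCompletion K), (p : ℤ) • P = 0 ∧ P ∉ W.localKernelOfReduction v) :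
    (∀ k : ℕ, ∃ P₁ : localPoints W (v.adicCompletion K), P₁ ∈ W.localKernelOfReduction v ∧ addOrderOf P₁ = p ^ k ∧
      ∀ P : localPoints W (v.adicCompletion K), P ∈ W.localKernelOfReduction v → ((p ^ k : ℕ) : ℤ) • P = 0 →
        ∃ c : ℕ, P = c • P₁) ∧
    (∀ a : localPoints W (v.adicCompletion K), a ∈ W.localKernelOfReduction v →
      ∃ b : localPoints W (v.adicCompletion K), b ∈ W.localKernelOfReduction v ∧ p • b = a) := by
  classical
  set L := AlgebraicClosure (v.adicCompletion K)
  let O : ValuationSubring L := (v.spectralValuation).valuationSubring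
  have hvO : (v.spectralValuation).Integers O := Valuation.valuationSubring.integers _
  have hΔ : IsUnit (W.localSpectralModel v).Δ := W.isUnit_Δ_localSpectralModel hgood
  have hΔ' : IsUnit (show WeierstrassCurve O from W.localSpectralModel v).Δ := hΔ
  haveI : CharZero (v.adicCompletion K) :=
    charZero_of_injective_algebraMap (algebraMap K (v.adicCompletion K)).injective
  haveI : CharZero L := inferInstanceAs (CharZero (AlgebraicClosure (v.adicCompletion K)))
  haveI hkv : CharP (IsLocalRing.ResidueField (v.adicCompletionIntegers K)) p :=
    ringChar.of_eq (ringChar_residueField_eq v hp.out hpv)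
  haveI : CharP (IsLocalRing.ResidueField O) p := (RingHom.charP_iff_charP (v.residueFieldToSpectral) p).mp hkv
  set T := W.localPointsEquivSpectralModel v with hTdef
  -- `E₁(K̄_v) = ker (red ∘ T)`
  have hred : ∀ P : localPoints W (v.adicCompletion K), P ∈ W.localKernelOfReduction v ↔
      goodReductionHom (W.localSpectralModel v) (Valuation.integer.integers v.spectralValuation) hΔ (T P) = 0 :=
    fun P ↦ (W.mem_localKernelOfReduction_iff v P).trans (goodReductionHom_eq_zero_iff _ hΔ _).symm
  -- the ordinary point on the model
  have hordM : ∃ P : ((show WeierstrassCurve O from W.localSpectralModel v).baseChange L).toAffine.Point,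
      (p : ℤ) • P = 0 ∧ goodReductionHom _ hvO hΔ' P ≠ 0 := by
    obtain ⟨P, hpP, hP⟩ := hord
    have h1 : (p : ℤ) • T P = 0 := by rw [← map_zsmul, hpP, map_zero]
    have h2 : goodReductionHom (W.localSpectralModel v) (Valuation.integer.integers v.spectralValuation) hΔ (T P) ≠ 0 :=
      fun h ↦ hP ((hred P).mpr h)
    exact ⟨_, h1, h2⟩
  refine ⟨fun k ↦ ?_, fun a ha ↦ ?_⟩
  · obtain ⟨P₁, hP₁, hord₁, hgen₁⟩ := exists_generator_torsionBy_ker_goodReductionHom O hvO hΔ' hordM k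
    -- retype the outputs on the `v.integer`-model (definitionally the same objects)
    set Q₁ : ((W.localSpectralModel v).baseChange L).toAffine.Point := P₁ with hQ₁
    have hQ₁red : goodReductionHom (W.localSpectralModel v) (Valuation.integer.integers v.spectralValuation) hΔ
        Q₁ = 0 := hP₁
    have hQ₁ord : addOrderOf Q₁ = p ^ k := hord₁
    have hQ₁gen : ∀ P : ((W.localSpectralModel v).baseChange L).toAffine.Point,
        goodReductionHom (W.localSpectralModel v) (Valuation.integer.integers v.spectralValuation) hΔ P = 0 →
          ((p ^ k : ℕ) : ℤ) • P = 0 → ∃ c : ℕ, P = c • Q₁ := hgen₁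
    refine ⟨T.symm Q₁, (hred _).mpr (by rw [AddEquiv.apply_symm_apply]; exact hQ₁red), ?_, fun P hP hpP ↦ ?_⟩
    · rw [← hQ₁ord]
      exact addOrderOf_injective T.symm.toAddMonoidHom T.symm.injective Q₁
    · obtain ⟨c, hc⟩ := hQ₁gen (T P) ((hred P).mp hP) (by rw [← map_zsmul T, hpP, map_zero])
      exact ⟨c, T.injective (by rw [hc, map_nsmul, AddEquiv.apply_symm_apply])⟩
  · obtain ⟨R, hR, hpR⟩ := exists_nsmul_eq_of_goodReductionHom_eq_zero O hvO hΔ' hordM (T a) ((hred a).mp ha)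
    set R₁ : ((W.localSpectralModel v).baseChange L).toAffine.Point := R with hR₁
    have hR₁red : goodReductionHom (W.localSpectralModel v) (Valuation.integer.integers v.spectralValuation) hΔ
        R₁ = 0 := hR
    have hpR₁ : p • R₁ = T a := hpR
    exact ⟨T.symm R₁, (hred _).mpr (by rw [AddEquiv.apply_symm_apply]; exact hR₁red),
      T.injective (by rw [map_nsmul, AddEquiv.apply_symm_apply, hpR₁])⟩

/-- **`E₁(K̄_v) ∩ E[p^k]` is cyclic of order `p^k` on a generator** (good reduction at `v ∋ p`, ordinary point).
[cite: GreenbergLNM1716, §1 p. 62 (ℱ[p^∞] ≅ ℚ_p/ℤ_p)] [cite: Howard2004HeegnerKolyvagin, §3.1 (arXiv p. 15, L56–58: Fil_v)] -/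
theorem exists_generator_localKernelOfReduction_torsion (hgood : W.HasGoodReductionAt v)
    (hpv : (p : 𝓞 K) ∈ v.asIdeal)
    (hord : ∃ P : localPoints W (v.adicCompletion K), (p : ℤ) • P = 0 ∧ P ∉ W.localKernelOfReduction v) (k : ℕ) :
    ∃ P₁ : localPoints W (v.adicCompletion K), P₁ ∈ W.localKernelOfReduction v ∧ addOrderOf P₁ = p ^ k ∧
      ∀ P : localPoints W (v.adicCompletion K), P ∈ W.localKernelOfReduction v → ((p ^ k : ℕ) : ℤ) • P = 0 →
        ∃ c : ℕ, P = c • P₁ :=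
  (W.localKernelOfReduction_ordinary_filtration v hgood hpv hord).1 k

/-- **`E₁(K̄_v)` is `p`-divisible** (good reduction at `v ∋ p`, ordinary point): every `a ∈ E₁(K̄_v)` is `p • b` with
`b ∈ E₁(K̄_v)`. [cite: GreenbergLNM1716, §2 p. 82 («since 𝓕(𝔪̄) is divisible»)] -/
theorem exists_nsmul_eq_of_mem_localKernelOfReduction (hgood : W.HasGoodReductionAt v)
    (hpv : (p : 𝓞 K) ∈ v.asIdeal)
    (hord : ∃ P : localPoints W (v.adicCompletion K), (p : ℤ) • P = 0 ∧ P ∉ W.localKernelOfReduction v)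
    {a : localPoints W (v.adicCompletion K)} (ha : a ∈ W.localKernelOfReduction v) :
    ∃ b : localPoints W (v.adicCompletion K), b ∈ W.localKernelOfReduction v ∧ p • b = a :=
  (W.localKernelOfReduction_ordinary_filtration v hgood hpv hord).2 a ha

/-! ## §2 `Fil_v E[p^k] = torsionFilAt W v (p^k)` is cyclic -/

omit hp in
/-- An ordinary point of `E(K̄)` (a `p`-torsion point outside `Fil_v E[p]`) gives an ordinary point of `E(K̄_v)`
(outside `E₁(K̄_v)`), through the chosen embedding `K̄ → K̄_v`. [cite: GreenbergLNM1716, §1 p. 62] -/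
theorem exists_ordinaryPoint_local_of_not_mem_torsionFilAt
    (hord : ∃ P : geomTorsion W (p : ℤ), P ∉ W.torsionFilAt v (p : ℤ)) :
    ∃ P : localPoints W (v.adicCompletion K), (p : ℤ) • P = 0 ∧ P ∉ W.localKernelOfReduction v := by
  obtain ⟨P, hP⟩ := hord
  refine ⟨pointsMapOfEmb W (closureEmb (K := K) (v.adicCompletion K)) (P : geomPoints W), ?_,
    fun h ↦ hP ((W.mem_torsionFilAt_iff v _ P).mpr h)⟩
  have hP0 : (p : ℤ) • (P : geomPoints W) = 0 := (mem_geomTorsion_iff W _ _).mp P.2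
  have h := congrArg (pointsMapOfEmb W (closureEmb (K := K) (v.adicCompletion K))) hP0
  rwa [map_zsmul, map_zero] at h

/-- **`Fil_v E[p^k]` is cyclic**: at a place `v ∋ p` of good reduction with an ordinary point, there is
`P₀ ∈ torsionFilAt W v (p^k)` of which every element of `torsionFilAt W v (p^k)` is an integer multiple (the injective
`pointsMapOfEmb` embeds `Fil_v E[p^k]` into the cyclic `E₁(K̄_v) ∩ E[p^k]`; a subgroup of a cyclic group is cyclic).
[cite: GreenbergLNM1716, §1 p. 62 (ℱ[p^k] cyclic)] [cite: Howard2004HeegnerKolyvagin, §3.1 (arXiv p. 15, L56–62: Fil_v T has rank one)] -/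
theorem exists_generator_torsionFilAt (hgood : W.HasGoodReductionAt v) (hpv : (p : 𝓞 K) ∈ v.asIdeal)
    (hord : ∃ P : localPoints W (v.adicCompletion K), (p : ℤ) • P = 0 ∧ P ∉ W.localKernelOfReduction v) (k : ℕ) :
    ∃ P₀ ∈ W.torsionFilAt v ((p : ℤ) ^ k), ∀ P ∈ W.torsionFilAt v ((p : ℤ) ^ k), ∃ c : ℤ, P = c • P₀ := by
  obtain ⟨P₁, hP₁, -, hgen⟩ := W.exists_generator_localKernelOfReduction_torsion v hgood hpv hord k
  set ι := pointsMapOfEmb W (closureEmb (K := K) (v.adicCompletion K)) with hι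
  -- every element of `Fil_v E[p^k]` maps to a multiple of `P₁`
  have hmul : ∀ P ∈ W.torsionFilAt v ((p : ℤ) ^ k), ι (P : geomPoints W) ∈ AddSubgroup.zmultiples P₁ := by
    intro P hP
    have htor : ((p ^ k : ℕ) : ℤ) • ι (P : geomPoints W) = 0 := by
      rw [Nat.cast_pow]
      have hP0 : ((p : ℤ) ^ k) • (P : geomPoints W) = 0 := (mem_geomTorsion_iff W _ _).mp P.2
      have h := congrArg ι hP0
      rwa [map_zsmul, map_zero] at h
    obtain ⟨c, hc⟩ := hgen _ ((W.mem_torsionFilAt_iff v _ P).mp hP) htor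
    exact AddSubgroup.mem_zmultiples_iff.mpr ⟨c, by rw [hc, natCast_zsmul]⟩
  -- the embedding `Fil_v E[p^k] ↪ ℤ • P₁`
  let f : W.torsionFilAt v ((p : ℤ) ^ k) →+ AddSubgroup.zmultiples P₁ :=
    { toFun := fun P ↦ ⟨ι ((P : geomTorsion W ((p : ℤ) ^ k)) : geomPoints W), hmul _ P.2⟩
      map_zero' := by ext; simp
      map_add' := fun P Q ↦ by ext; simp }
  have hf : Function.Injective f := fun P Q h ↦ by
    apply Subtype.ext; apply Subtype.ext
    exact pointsMapOfEmb_injective W _ (congrArg Subtype.val h)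
  haveI : IsAddCyclic (W.torsionFilAt v ((p : ℤ) ^ k)) := isAddCyclic_of_injective f hf
  obtain ⟨g, hg⟩ := IsAddCyclic.exists_generator (α := W.torsionFilAt v ((p : ℤ) ^ k))
  refine ⟨(g : geomTorsion W ((p : ℤ) ^ k)), g.2, fun P hP ↦ ?_⟩
  obtain ⟨n, hn⟩ := AddSubgroup.mem_zmultiples_iff.mp (hg ⟨P, hP⟩)
  exact ⟨n, by rw [← Submodule.coe_smul_of_tower, hn]⟩

/-- The same with the ordinary point given on `E(K̄)`: some `p`-torsion point of `E(K̄)` lies outside `Fil_v E[p]`.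
[cite: GreenbergLNM1716, §1 p. 62] [cite: Howard2004HeegnerKolyvagin, §3.1] -/
theorem exists_generator_torsionFilAt_of_not_mem (hgood : W.HasGoodReductionAt v) (hpv : (p : 𝓞 K) ∈ v.asIdeal)
    (hord : ∃ P : geomTorsion W (p : ℤ), P ∉ W.torsionFilAt v (p : ℤ)) (k : ℕ) :
    ∃ P₀ ∈ W.torsionFilAt v ((p : ℤ) ^ k), ∀ P ∈ W.torsionFilAt v ((p : ℤ) ^ k), ∃ c : ℤ, P = c • P₀ :=
  W.exists_generator_torsionFilAt v hgood hpv (W.exists_ordinaryPoint_local_of_not_mem_torsionFilAt v hord) k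

/-! ## §3 Alternating pairings vanish on `Fil_v E[p^k] × Fil_v E[p^k]` -/

/-- **`Fil_v E[p^k]` is isotropic for every bi-additive pairing `e` on `E[p^k]` with `e(a, a) = 0`** (the Weil pairing:
`e_{p^k}(T, T) = 1`): `e(c P₀, d P₀) = c d · e(P₀, P₀) = 0` on the cyclic `Fil_v` — the `E`-level input of the isotropy of
Howard's ordinary condition at `v ∣ p` (Lemma 3.1.1: «`Fil_v T_𝔭` is its own exact orthogonal complement»).
[cite: Howard2004HeegnerKolyvagin, Lemma 3.1.1 (arXiv p. 15, L60–62)] [cite: SilvermanAEC2009, Prop. III.8.1 (e_m alternating)] -/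
theorem pairing_torsionFilAt_eq_zero {P : Type*} [AddCommGroup P] (hgood : W.HasGoodReductionAt v)
    (hpv : (p : 𝓞 K) ∈ v.asIdeal)
    (hord : ∃ Q : localPoints W (v.adicCompletion K), (p : ℤ) • Q = 0 ∧ Q ∉ W.localKernelOfReduction v) (k : ℕ)
    (e : geomTorsion W ((p : ℤ) ^ k) →+ geomTorsion W ((p : ℤ) ^ k) →+ P) (hself : ∀ a, e a a = 0) :
    ∀ a ∈ W.torsionFilAt v ((p : ℤ) ^ k), ∀ b ∈ W.torsionFilAt v ((p : ℤ) ^ k), e a b = 0 := by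
  obtain ⟨P₀, -, hP₀⟩ := W.exists_generator_torsionFilAt v hgood hpv hord k
  intro a ha b hb
  obtain ⟨c, rfl⟩ := hP₀ a ha
  obtain ⟨d, rfl⟩ := hP₀ b hb
  have h1 : e (c • P₀) P₀ = 0 := by
    rw [← AddMonoidHom.flip_apply e, map_zsmul, AddMonoidHom.flip_apply, hself, zsmul_zero]
  rw [map_zsmul, h1, zsmul_zero]

end WeierstrassCurve

end
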